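import Mathlib
import Summits.MatrixMultiplication.MatrixMultiplication.Theorems.FidelityWitnessesRankTwoAdditivityNorms

/-!
# `FidelityWitnesses.RankTwoAdditivity` (stmt-MatrixMultiplication-4964) — vector toolkit

Elementary inequalities for vectors `μ → ℂ` (with `⟪u,v⟫ = ∑ conj (u i) * v i`) used in the balanced case of the
key lemma for the core inequality: `|tr M|² ≤ ‖M‖_F² + 2|det M|` for 2×2 matrices (`norm_trace_sq_le_two`),
Bessel for an orthogonal pair (`bessel_pair`), Lagrange's identity, Cauchy–Schwarz for bivectors
(`wedge_cauchy_schwarz`), and the rank-two von Neumann inequality in Gram form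
`|⟪c₀,a₀⟫ + ⟪c₁,a₁⟫|² ≤ tr(G_aG_c) + 2√(det G_a det G_c)` (`vn2`, via Gram–Schmidt `vn2_core`).
Supports item `stmt-MatrixMultiplication-4964`; no definitions are introduced.
-/

namespace Summit.MatrixMultiplication.MatrixMultiplication.Theorems.RankTwoAdditivity

open scoped BigOperators ComplexConjugate

/-- For complex numbers `m₁₁ m₁₂ m₂₁ m₂₂` (a 2×2 matrix):
`|m₁₁ + m₂₂|² ≤ |m₁₁|² + |m₁₂|² + |m₂₁|² + |m₂₂|² + 2|m₁₁m₂₂ − m₁₂m₂₁|`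
(i.e. `|tr M|² ≤ ‖M‖_F² + 2|det M|`, equivalently `|tr M| ≤ σ₁ + σ₂`). [folklore] -/
theorem norm_trace_sq_le_two (m₁₁ m₁₂ m₂₁ m₂₂ : ℂ) :
    ‖m₁₁ + m₂₂‖ ^ 2 ≤ ‖m₁₁‖ ^ 2 + ‖m₁₂‖ ^ 2 + ‖m₂₁‖ ^ 2 + ‖m₂₂‖ ^ 2
      + 2 * ‖m₁₁ * m₂₂ - m₁₂ * m₂₁‖ := by
  -- |m₁₁ + m₂₂|² = |m₁₁|² + |m₂₂|² + 2 Re(m₁₁ conj m₂₂)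
  have hexp : ‖m₁₁ + m₂₂‖ ^ 2 = ‖m₁₁‖ ^ 2 + ‖m₂₂‖ ^ 2 + 2 * (m₁₁ * conj m₂₂).re := by
    rw [Complex.sq_norm, Complex.sq_norm, Complex.sq_norm, Complex.normSq_add]
  -- Re(m₁₁ conj m₂₂) ≤ |m₁₁ m₂₂| ≤ |det| + |m₁₂ m₂₁| ≤ |det| + (|m₁₂|² + |m₂₁|²)/2
  have h1 : (m₁₁ * conj m₂₂).re ≤ ‖m₁₁ * m₂₂‖ := by
    calc (m₁₁ * conj m₂₂).re ≤ ‖m₁₁ * conj m₂₂‖ := Complex.re_le_norm _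
      _ = ‖m₁₁ * m₂₂‖ := by rw [norm_mul, norm_mul, Complex.norm_conj]
  have h2 : ‖m₁₁ * m₂₂‖ ≤ ‖m₁₁ * m₂₂ - m₁₂ * m₂₁‖ + ‖m₁₂ * m₂₁‖ := by
    calc ‖m₁₁ * m₂₂‖ = ‖(m₁₁ * m₂₂ - m₁₂ * m₂₁) + m₁₂ * m₂₁‖ := by rw [sub_add_cancel]
      _ ≤ ‖m₁₁ * m₂₂ - m₁₂ * m₂₁‖ + ‖m₁₂ * m₂₁‖ := norm_add_le _ _
  have h3 : ‖m₁₂ * m₂₁‖ ≤ (‖m₁₂‖ ^ 2 + ‖m₂₁‖ ^ 2) / 2 := by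
    rw [norm_mul]; nlinarith [sq_nonneg (‖m₁₂‖ - ‖m₂₁‖)]
  rw [hexp]
  linarith


/-- Expansion of `‖c − α e₀ − β e₁‖²` is not needed in full; we only need **Bessel's inequality** for an
orthogonal pair of vectors of norm ≤ 1: `|⟪e₀,c⟫|² + |⟪e₁,c⟫|² ≤ ‖c‖²`. [folklore] -/
theorem bessel_pair {μ : Type*} [Fintype μ] (e₀ e₁ c : μ → ℂ)
    (h₀ : (∑ i, ‖e₀ i‖ ^ 2) ≤ 1) (h₁ : (∑ i, ‖e₁ i‖ ^ 2) ≤ 1)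
    (horth : (∑ i, conj (e₀ i) * e₁ i) = 0) :
    ‖∑ i, conj (e₀ i) * c i‖ ^ 2 + ‖∑ i, conj (e₁ i) * c i‖ ^ 2 ≤ ∑ i, ‖c i‖ ^ 2 := by
  set α : ℂ := ∑ i, conj (e₀ i) * c i with hα
  set β : ℂ := ∑ i, conj (e₁ i) * c i with hβ
  -- 0 ≤ ‖c − α e₀ − β e₁‖² = ‖c‖² − (2 − ‖e₀‖²)|α|² − (2 − ‖e₁‖²)|β|²  ≤ ‖c‖² − |α|² − |β|²
  have key : (∑ i, ‖c i + -(α * e₀ i + β * e₁ i)‖ ^ 2)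
      = (∑ i, ‖c i‖ ^ 2) - (2 - ∑ i, ‖e₀ i‖ ^ 2) * ‖α‖ ^ 2 - (2 - ∑ i, ‖e₁ i‖ ^ 2) * ‖β‖ ^ 2 := by
    rw [norm_sq_add_sum]
    have e1 : (∑ i, ‖-(α * e₀ i + β * e₁ i)‖ ^ 2)
        = ‖α‖ ^ 2 * (∑ i, ‖e₀ i‖ ^ 2) + ‖β‖ ^ 2 * (∑ i, ‖e₁ i‖ ^ 2) := by
      have h := norm_sq_add_sum (fun i => α * e₀ i) (fun i => β * e₁ i)
      have e11 : (∑ i, ‖α * e₀ i‖ ^ 2) = ‖α‖ ^ 2 * ∑ i, ‖e₀ i‖ ^ 2 := by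
        rw [Finset.mul_sum]; exact Finset.sum_congr rfl fun i _ => by rw [norm_mul, mul_pow]
      have e12 : (∑ i, ‖β * e₁ i‖ ^ 2) = ‖β‖ ^ 2 * ∑ i, ‖e₁ i‖ ^ 2 := by
        rw [Finset.mul_sum]; exact Finset.sum_congr rfl fun i _ => by rw [norm_mul, mul_pow]
      have e13 : (∑ i, conj (α * e₀ i) * (β * e₁ i)) = conj α * β * ∑ i, conj (e₀ i) * e₁ i := by
        rw [Finset.mul_sum]; exact Finset.sum_congr rfl fun i _ => by rw [map_mul]; ring
      simp only [norm_neg]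
      rw [h, e11, e12, e13, horth, mul_zero, Complex.zero_re, mul_zero, add_zero]
    have e2 : (∑ i, conj (c i) * -(α * e₀ i + β * e₁ i)) = -(α * conj α + β * conj β) := by
      have hαc : conj α = ∑ i, conj (c i) * e₀ i := by
        rw [hα, map_sum]; exact Finset.sum_congr rfl fun i _ => by rw [map_mul, Complex.conj_conj, mul_comm]
      have hβc : conj β = ∑ i, conj (c i) * e₁ i := by
        rw [hβ, map_sum]; exact Finset.sum_congr rfl fun i _ => by rw [map_mul, Complex.conj_conj, mul_comm]
      rw [hαc, hβc, Finset.mul_sum, Finset.mul_sum, ← Finset.sum_add_distrib, ← Finset.sum_neg_distrib]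
      exact Finset.sum_congr rfl fun i _ => by ring
    rw [e1, e2]
    simp only [Complex.neg_re, Complex.add_re, Complex.mul_conj', ← Complex.ofReal_pow, Complex.ofReal_re]
    ring
  have hnn : 0 ≤ (∑ i, ‖c i + -(α * e₀ i + β * e₁ i)‖ ^ 2) := Finset.sum_nonneg fun _ _ => by positivity
  rw [key] at hnn
  nlinarith [norm_nonneg α, norm_nonneg β, sq_nonneg ‖α‖, sq_nonneg ‖β‖]

/-- **Lagrange's identity**: `∑_{i,j} |c_i d_j − c_j d_i|² = 2 (‖c‖²‖d‖² − |⟪c,d⟫|²)`. [folklore] -/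
theorem lagrange_identity {μ : Type*} [Fintype μ] (c d : μ → ℂ) :
    (∑ p : μ × μ, ‖c p.1 * d p.2 - c p.2 * d p.1‖ ^ 2)
      = 2 * ((∑ i, ‖c i‖ ^ 2) * (∑ i, ‖d i‖ ^ 2) - ‖∑ i, conj (c i) * d i‖ ^ 2) := by
  -- work in ℂ
  apply Complex.ofReal_injective
  push_cast
  simp_rw [← Complex.mul_conj']
  rw [Fintype.sum_prod_type]
  simp only [map_sub, map_mul, map_sum, Complex.conj_conj]
  have : ∀ i j, (c i * d j - c j * d i) * (conj (c i) * conj (d j) - conj (c j) * conj (d i))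
      = c i * conj (c i) * (d j * conj (d j)) + c j * conj (c j) * (d i * conj (d i))
        - (conj (c i) * d i) * (c j * conj (d j)) - (conj (c j) * d j) * (c i * conj (d i)) := by
    intro i j; ring
  simp_rw [this, Finset.sum_sub_distrib, Finset.sum_add_distrib, ← Finset.mul_sum, ← Finset.sum_mul]
  simp only [← Finset.mul_sum]
  ring

/-- **Cauchy–Schwarz for bivectors**: `|⟪c,e⟫⟪c',e'⟫ − ⟪c,e'⟫⟪c',e⟫|² ≤ det G_c · det G_e`, where
`det G_c = ‖c‖²‖c'‖² − |⟪c,c'⟫|²`. [folklore] -/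
theorem wedge_cauchy_schwarz {μ : Type*} [Fintype μ] (c c' e e' : μ → ℂ) :
    ‖(∑ i, conj (c i) * e i) * (∑ i, conj (c' i) * e' i)
        - (∑ i, conj (c i) * e' i) * (∑ i, conj (c' i) * e i)‖ ^ 2
      ≤ ((∑ i, ‖c i‖ ^ 2) * (∑ i, ‖c' i‖ ^ 2) - ‖∑ i, conj (c i) * c' i‖ ^ 2)
        * ((∑ i, ‖e i‖ ^ 2) * (∑ i, ‖e' i‖ ^ 2) - ‖∑ i, conj (e i) * e' i‖ ^ 2) := by
  -- Cauchy–Binet: the bivector pairing is half the inner product of the wedge arrays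
  have hcb : (∑ i, conj (c i) * e i) * (∑ i, conj (c' i) * e' i)
        - (∑ i, conj (c i) * e' i) * (∑ i, conj (c' i) * e i)
      = (1 / 2 : ℂ) * ∑ p : μ × μ, conj (c p.1 * c' p.2 - c p.2 * c' p.1) * (e p.1 * e' p.2 - e p.2 * e' p.1) := by
    rw [Fintype.sum_prod_type]
    simp only [map_sub, map_mul]
    have : ∀ i j, (conj (c i) * conj (c' j) - conj (c j) * conj (c' i)) * (e i * e' j - e j * e' i)
        = (conj (c i) * e i) * (conj (c' j) * e' j) + (conj (c j) * e j) * (conj (c' i) * e' i)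
          - (conj (c i) * e' i) * (conj (c' j) * e j) - (conj (c j) * e' j) * (conj (c' i) * e i) := by
      intro i j; ring
    simp_rw [this, Finset.sum_sub_distrib, Finset.sum_add_distrib, ← Finset.mul_sum, ← Finset.sum_mul]
    simp only [← Finset.mul_sum]
    ring
  rw [hcb, norm_mul, mul_pow]
  have hcs := norm_sq_hsum_le (fun p : μ × μ => c p.1 * c' p.2 - c p.2 * c' p.1)
    (fun p : μ × μ => e p.1 * e' p.2 - e p.2 * e' p.1)
  rw [lagrange_identity c c', lagrange_identity e e'] at hcs
  have h4 : ‖(1 / 2 : ℂ)‖ ^ 2 = 1 / 4 := by norm_num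
  rw [h4]
  nlinarith [hcs, norm_nonneg (∑ p : μ × μ, conj (c p.1 * c' p.2 - c p.2 * c' p.1) * (e p.1 * e' p.2 - e p.2 * e' p.1))]


/-- `‖⟪u,v⟫‖ = ‖⟪v,u⟫‖`. -/
theorem norm_hsum_comm {μ : Type*} [Fintype μ] (u v : μ → ℂ) :
    ‖∑ i, conj (u i) * v i‖ = ‖∑ i, conj (v i) * u i‖ := by
  have : (∑ i, conj (v i) * u i) = conj (∑ i, conj (u i) * v i) := by
    rw [map_sum]; exact Finset.sum_congr rfl fun i _ => by rw [map_mul, Complex.conj_conj, mul_comm]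
  rw [this, Complex.norm_conj]

/-- Core of the rank-two von Neumann inequality: for an orthogonal pair `e₀, e₁` of norm ≤ 1 and any
`c₀, c₁`: `|⟪c₀,e₀⟫ + ⟪c₁,e₁⟫|² ≤ ‖c₀‖² + ‖c₁‖² + 2 √(det G_c)`, `det G_c = ‖c₀‖²‖c₁‖² − |⟪c₀,c₁⟫|²`.
[folklore] -/
theorem vn2_core {μ : Type*} [Fintype μ] (e₀ e₁ c₀ c₁ : μ → ℂ)
    (h₀ : (∑ i, ‖e₀ i‖ ^ 2) ≤ 1) (h₁ : (∑ i, ‖e₁ i‖ ^ 2) ≤ 1)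
    (horth : (∑ i, conj (e₀ i) * e₁ i) = 0) :
    ‖(∑ i, conj (c₀ i) * e₀ i) + ∑ i, conj (c₁ i) * e₁ i‖ ^ 2
      ≤ (∑ i, ‖c₀ i‖ ^ 2) + (∑ i, ‖c₁ i‖ ^ 2)
        + 2 * Real.sqrt ((∑ i, ‖c₀ i‖ ^ 2) * (∑ i, ‖c₁ i‖ ^ 2) - ‖∑ i, conj (c₀ i) * c₁ i‖ ^ 2) := by
  set m₀₀ : ℂ := ∑ i, conj (c₀ i) * e₀ i
  set m₀₁ : ℂ := ∑ i, conj (c₀ i) * e₁ i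
  set m₁₀ : ℂ := ∑ i, conj (c₁ i) * e₀ i
  set m₁₁ : ℂ := ∑ i, conj (c₁ i) * e₁ i
  have hT1 := norm_trace_sq_le_two m₀₀ m₀₁ m₁₀ m₁₁
  -- Bessel for the rows
  have hb₀ : ‖m₀₀‖ ^ 2 + ‖m₀₁‖ ^ 2 ≤ ∑ i, ‖c₀ i‖ ^ 2 := by
    have h := bessel_pair e₀ e₁ c₀ h₀ h₁ horth
    rwa [norm_hsum_comm e₀ c₀, norm_hsum_comm e₁ c₀] at h
  have hb₁ : ‖m₁₀‖ ^ 2 + ‖m₁₁‖ ^ 2 ≤ ∑ i, ‖c₁ i‖ ^ 2 := by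
    have h := bessel_pair e₀ e₁ c₁ h₀ h₁ horth
    rwa [norm_hsum_comm e₀ c₁, norm_hsum_comm e₁ c₁] at h
  -- determinant bound via the bivector Cauchy–Schwarz
  set dc : ℝ := (∑ i, ‖c₀ i‖ ^ 2) * (∑ i, ‖c₁ i‖ ^ 2) - ‖∑ i, conj (c₀ i) * c₁ i‖ ^ 2 with hdc
  have hdc0 : 0 ≤ dc := by rw [hdc]; linarith [norm_sq_hsum_le c₀ c₁]
  have hde : (∑ i, ‖e₀ i‖ ^ 2) * (∑ i, ‖e₁ i‖ ^ 2) - ‖∑ i, conj (e₀ i) * e₁ i‖ ^ 2 ≤ 1 := by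
    rw [horth, norm_zero]
    have : 0 ≤ ∑ i, ‖e₀ i‖ ^ 2 := Finset.sum_nonneg fun _ _ => by positivity
    nlinarith
  have hdet : ‖m₀₀ * m₁₁ - m₀₁ * m₁₀‖ ^ 2 ≤ dc := by
    have h := wedge_cauchy_schwarz c₀ c₁ e₀ e₁
    calc ‖m₀₀ * m₁₁ - m₀₁ * m₁₀‖ ^ 2 ≤ dc * ((∑ i, ‖e₀ i‖ ^ 2) * (∑ i, ‖e₁ i‖ ^ 2)
          - ‖∑ i, conj (e₀ i) * e₁ i‖ ^ 2) := h
      _ ≤ dc * 1 := by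
          apply mul_le_mul_of_nonneg_left hde hdc0
      _ = dc := mul_one _
  have hdet' : ‖m₀₀ * m₁₁ - m₀₁ * m₁₀‖ ≤ Real.sqrt dc := by
    rw [← Real.sqrt_sq (norm_nonneg _)]
    exact Real.sqrt_le_sqrt hdet
  linarith


/-- Normalising a vector: with `n = √(∑‖a i‖²)` and `e = n⁻¹ • a` one has `∑‖e i‖² ≤ 1`, `a = n • e`,
and `∑ ‖e i‖² = 1` unless `a = 0`. -/
theorem normalize_aux {μ : Type*} [Fintype μ] (a : μ → ℂ) :
    let n : ℝ := Real.sqrt (∑ i, ‖a i‖ ^ 2)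
    (∑ i, ‖((n : ℂ)⁻¹ * a i)‖ ^ 2) ≤ 1 ∧ (∀ i, a i = (n : ℂ) * ((n : ℂ)⁻¹ * a i)) ∧
      ((∑ i, ‖((n : ℂ)⁻¹ * a i)‖ ^ 2) = 1 ∨ ∀ i, a i = 0) := by
  intro n
  have hn0 : 0 ≤ n := Real.sqrt_nonneg _
  have hn2 : n ^ 2 = ∑ i, ‖a i‖ ^ 2 := Real.sq_sqrt (Finset.sum_nonneg fun _ _ => by positivity)
  have hsum : (∑ i, ‖((n : ℂ)⁻¹ * a i)‖ ^ 2) = n⁻¹ ^ 2 * ∑ i, ‖a i‖ ^ 2 := by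
    rw [Finset.mul_sum]; refine Finset.sum_congr rfl fun i _ => ?_
    rw [norm_mul, norm_inv, Complex.norm_real, Real.norm_of_nonneg hn0, mul_pow]
  by_cases h : n = 0
  · have hall : ∀ i, a i = 0 := by
      have hs : (∑ i, ‖a i‖ ^ 2) = 0 := by rw [← hn2, h]; ring
      intro i
      have := (Finset.sum_eq_zero_iff_of_nonneg fun i _ => by positivity).1 hs i (Finset.mem_univ i)
      exact norm_eq_zero.1 ((pow_eq_zero_iff two_ne_zero).1 this)
    refine ⟨?_, fun i => ?_, Or.inr hall⟩
    · rw [hsum, h]; simp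
    · rw [hall i]; simp
  · have hn : (n : ℂ) ≠ 0 := by exact_mod_cast h
    have hone : (∑ i, ‖((n : ℂ)⁻¹ * a i)‖ ^ 2) = 1 := by
      rw [hsum, ← hn2, inv_pow]; exact inv_mul_cancel₀ (pow_ne_zero 2 h)
    exact ⟨hone.le, fun i => by rw [← mul_assoc, mul_inv_cancel₀ hn, one_mul], Or.inl hone⟩

/-- **Rank-two von Neumann inequality in Gram form.** For any vectors `a₀ a₁ c₀ c₁`:
`|⟪c₀,a₀⟫ + ⟪c₁,a₁⟫|² ≤ tr(G_a G_c) + 2 √(det G_a · det G_c)` where `G` are the 2×2 Gram matrices,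
`tr(G_aG_c) = ‖a₀‖²‖c₀‖² + ‖a₁‖²‖c₁‖² + 2Re(⟪a₀,a₁⟫⟪c₁,c₀⟫)`, `det G_a = ‖a₀‖²‖a₁‖² − |⟪a₀,a₁⟫|²`.
(This is `|tr Z|² ≤ ‖Z‖_F² + 2σ₁σ₂ = (σ₁+σ₂)²` for `Z = a₀c₀* + a₁c₁*`.) [folklore] -/
theorem vn2 {μ : Type*} [Fintype μ] (a₀ a₁ c₀ c₁ : μ → ℂ) :
    ‖(∑ i, conj (c₀ i) * a₀ i) + ∑ i, conj (c₁ i) * a₁ i‖ ^ 2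
      ≤ ((∑ i, ‖a₀ i‖ ^ 2) * (∑ i, ‖c₀ i‖ ^ 2) + (∑ i, ‖a₁ i‖ ^ 2) * (∑ i, ‖c₁ i‖ ^ 2)
          + 2 * ((∑ i, conj (a₀ i) * a₁ i) * ∑ i, conj (c₁ i) * c₀ i).re)
        + 2 * Real.sqrt (((∑ i, ‖a₀ i‖ ^ 2) * (∑ i, ‖a₁ i‖ ^ 2) - ‖∑ i, conj (a₀ i) * a₁ i‖ ^ 2)
            * ((∑ i, ‖c₀ i‖ ^ 2) * (∑ i, ‖c₁ i‖ ^ 2) - ‖∑ i, conj (c₀ i) * c₁ i‖ ^ 2)) := by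
  -- Gram–Schmidt on (a₀, a₁)
  obtain ⟨he₀, ha₀, hdich₀⟩ := normalize_aux a₀
  set n₀ : ℝ := Real.sqrt (∑ i, ‖a₀ i‖ ^ 2) with hn₀
  set e₀ : μ → ℂ := fun i => (n₀ : ℂ)⁻¹ * a₀ i with he₀def
  set α : ℂ := ∑ i, conj (e₀ i) * a₁ i with hα
  set r : μ → ℂ := fun i => a₁ i - α * e₀ i with hr
  obtain ⟨he₁, hr₁, hdich₁⟩ := normalize_aux r
  set n₁ : ℝ := Real.sqrt (∑ i, ‖r i‖ ^ 2) with hn₁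
  set e₁ : μ → ℂ := fun i => (n₁ : ℂ)⁻¹ * r i with he₁def
  have hn₀0 : 0 ≤ n₀ := Real.sqrt_nonneg _
  have hn₁0 : 0 ≤ n₁ := Real.sqrt_nonneg _
  -- e₀ has norm 1 or α = 0 with e₀ = 0
  have he₀sq : (∑ i, ‖e₀ i‖ ^ 2 : ℝ) = ((∑ i, ‖e₀ i‖ ^ 2 : ℝ) : ℂ) * ∑ i, ‖e₀ i‖ ^ 2 := by
    rcases hdich₀ with h | h
    · simp only [he₀def] at h ⊢; rw [h]; simp
    · have : ∀ i, e₀ i = 0 := fun i => by simp only [he₀def, h i, mul_zero]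
      simp [this]
  -- orthogonality ⟪e₀, r⟫ = 0
  have horth_r : (∑ i, conj (e₀ i) * r i) = 0 := by
    have : (∑ i, conj (e₀ i) * r i) = α - α * ∑ i, conj (e₀ i) * e₀ i := by
      simp only [hr, mul_sub, Finset.sum_sub_distrib, ← hα]
      rw [Finset.mul_sum]; congr 1; exact Finset.sum_congr rfl fun i _ => by ring
    rw [this]
    have hee : (∑ i, conj (e₀ i) * e₀ i) = ((∑ i, ‖e₀ i‖ ^ 2 : ℝ) : ℂ) := by
      push_cast; exact Finset.sum_congr rfl fun i _ => by rw [Complex.conj_mul']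
    rw [hee]
    rcases hdich₀ with h | h
    · simp only [he₀def] at h ⊢; rw [h]; simp
    · have hα0 : α = 0 := by
        rw [hα]; exact Finset.sum_eq_zero fun i _ => by simp only [he₀def, h i, mul_zero, map_zero, zero_mul]
      rw [hα0]; ring
  have horth : (∑ i, conj (e₀ i) * e₁ i) = 0 := by
    have : (∑ i, conj (e₀ i) * e₁ i) = (n₁ : ℂ)⁻¹ * ∑ i, conj (e₀ i) * r i := by
      rw [Finset.mul_sum]; exact Finset.sum_congr rfl fun i _ => by simp only [he₁def]; ring
    rw [this, horth_r, mul_zero]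
  -- a₁ = α e₀ + n₁ e₁
  have ha₁ : ∀ i, a₁ i = α * e₀ i + (n₁ : ℂ) * e₁ i := by
    intro i; have := hr₁ i; simp only [he₁def]; rw [← this]; simp only [hr]; ring
  -- the transformed c's
  set d₀ : μ → ℂ := fun i => (n₀ : ℂ) * c₀ i + conj α * c₁ i with hd₀
  set d₁ : μ → ℂ := fun i => (n₁ : ℂ) * c₁ i with hd₁
  have hcore := vn2_core e₀ e₁ d₀ d₁ he₀ he₁ horth
  -- trace identity
  have htr : (∑ i, conj (d₀ i) * e₀ i) + ∑ i, conj (d₁ i) * e₁ i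
      = (∑ i, conj (c₀ i) * a₀ i) + ∑ i, conj (c₁ i) * a₁ i := by
    have e1 : (∑ i, conj (c₀ i) * a₀ i) = ∑ i, (n₀ : ℂ) * (conj (c₀ i) * e₀ i) :=
      Finset.sum_congr rfl fun i _ => by rw [ha₀ i]; simp only [he₀def]; ring
    have e2 : (∑ i, conj (c₁ i) * a₁ i) = ∑ i, (α * (conj (c₁ i) * e₀ i) + (n₁ : ℂ) * (conj (c₁ i) * e₁ i)) :=
      Finset.sum_congr rfl fun i _ => by rw [ha₁ i]; ring
    rw [e1, e2, Finset.sum_add_distrib, ← add_assoc]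
    congr 1
    · rw [← Finset.sum_add_distrib]
      exact Finset.sum_congr rfl fun i _ => by simp only [hd₀, map_add, map_mul, Complex.conj_ofReal, Complex.conj_conj]; ring
    · exact Finset.sum_congr rfl fun i _ => by simp only [hd₁, map_mul, Complex.conj_ofReal]; ring
  rw [htr] at hcore
  -- basic Gram data of c
  set gc₀ : ℝ := ∑ i, ‖c₀ i‖ ^ 2 with hgc₀
  set gc₁ : ℝ := ∑ i, ‖c₁ i‖ ^ 2 with hgc₁
  set w : ℂ := ∑ i, conj (c₀ i) * c₁ i with hw
  have hwc : (∑ i, conj (c₁ i) * c₀ i) = conj w := by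
    rw [hw, map_sum]; exact Finset.sum_congr rfl fun i _ => by rw [map_mul, Complex.conj_conj, mul_comm]
  -- norms and inner products of d₀, d₁
  have hd₀n : (∑ i, ‖d₀ i‖ ^ 2) = n₀ ^ 2 * gc₀ + ‖α‖ ^ 2 * gc₁ + 2 * ((n₀ : ℂ) * α * conj w).re := by
    have h := norm_sq_add_sum (fun i => (n₀ : ℂ) * c₀ i) (fun i => conj α * c₁ i)
    have e1 : (∑ i, ‖(n₀ : ℂ) * c₀ i‖ ^ 2) = n₀ ^ 2 * gc₀ := by
      rw [hgc₀, Finset.mul_sum]; exact Finset.sum_congr rfl fun i _ => by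
        rw [norm_mul, Complex.norm_real, Real.norm_of_nonneg hn₀0, mul_pow]
    have e2 : (∑ i, ‖conj α * c₁ i‖ ^ 2) = ‖α‖ ^ 2 * gc₁ := by
      rw [hgc₁, Finset.mul_sum]; exact Finset.sum_congr rfl fun i _ => by rw [norm_mul, Complex.norm_conj, mul_pow]
    have e3 : (∑ i, conj ((n₀ : ℂ) * c₀ i) * (conj α * c₁ i)) = (n₀ : ℂ) * conj α * w := by
      rw [hw, Finset.mul_sum]; exact Finset.sum_congr rfl fun i _ => by simp only [map_mul, Complex.conj_ofReal]; ring
    have e4 : ((n₀ : ℂ) * conj α * w).re = ((n₀ : ℂ) * α * conj w).re := by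
      have : (n₀ : ℂ) * α * conj w = conj ((n₀ : ℂ) * conj α * w) := by
        simp only [map_mul, Complex.conj_ofReal, Complex.conj_conj]
      rw [this, Complex.conj_re]
    simp only [hd₀]; rw [h, e1, e2, e3, e4]
  have hd₁n : (∑ i, ‖d₁ i‖ ^ 2) = n₁ ^ 2 * gc₁ := by
    rw [hgc₁, Finset.mul_sum]; exact Finset.sum_congr rfl fun i _ => by
      simp only [hd₁]; rw [norm_mul, Complex.norm_real, Real.norm_of_nonneg hn₁0, mul_pow]
  have hd₀₁ : (∑ i, conj (d₀ i) * d₁ i) = (n₁ : ℂ) * ((n₀ : ℂ) * w + α * gc₁) := by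
    have : (gc₁ : ℂ) = ∑ i, conj (c₁ i) * c₁ i := by
      rw [hgc₁]; push_cast; exact Finset.sum_congr rfl fun i _ => by rw [Complex.conj_mul']
    rw [this, hw, Finset.mul_sum, Finset.mul_sum, ← Finset.sum_add_distrib, Finset.mul_sum]
    exact Finset.sum_congr rfl fun i _ => by
      simp only [hd₀, hd₁, map_add, map_mul, Complex.conj_ofReal, Complex.conj_conj]; ring
  -- Gram data of a
  have ha₀n : (∑ i, ‖a₀ i‖ ^ 2) = n₀ ^ 2 := (Real.sq_sqrt (Finset.sum_nonneg fun _ _ => by positivity)).symm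
  have ha₁n : (∑ i, ‖a₁ i‖ ^ 2) = ‖α‖ ^ 2 + n₁ ^ 2 := by
    -- ‖a₁‖² = ‖α e₀ + r‖² = |α|²‖e₀‖² + ‖r‖² (r ⊥ e₀) and |α|²‖e₀‖² = |α|²
    have h := norm_sq_add_sum (fun i => α * e₀ i) r
    have e0 : ∀ i, α * e₀ i + r i = a₁ i := fun i => by simp only [hr]; ring
    simp only [e0] at h
    have e1 : (∑ i, ‖α * e₀ i‖ ^ 2) = ‖α‖ ^ 2 * ∑ i, ‖e₀ i‖ ^ 2 := by
      rw [Finset.mul_sum]; exact Finset.sum_congr rfl fun i _ => by rw [norm_mul, mul_pow]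
    have e2 : (∑ i, conj (α * e₀ i) * r i) = conj α * ∑ i, conj (e₀ i) * r i := by
      rw [Finset.mul_sum]; exact Finset.sum_congr rfl fun i _ => by rw [map_mul]; ring
    have e3 : (∑ i, ‖r i‖ ^ 2) = n₁ ^ 2 := (Real.sq_sqrt (Finset.sum_nonneg fun _ _ => by positivity)).symm
    rw [h, e1, e2, horth_r, mul_zero, Complex.zero_re, mul_zero, add_zero, e3]
    rcases hdich₀ with h0 | h0
    · simp only [he₀def] at h0 ⊢; rw [h0, mul_one]
    · have hα0 : α = 0 := by
        rw [hα]; exact Finset.sum_eq_zero fun i _ => by simp only [he₀def, h0 i, mul_zero, map_zero, zero_mul]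
      rw [hα0]; simp
  have ha₀₁ : (∑ i, conj (a₀ i) * a₁ i) = (n₀ : ℂ) * α := by
    rw [hα, Finset.mul_sum]; exact Finset.sum_congr rfl fun i _ => by
      rw [ha₀ i]; simp only [he₀def, map_mul, Complex.conj_ofReal]; ring
  -- assemble: the two right-hand sides agree
  rw [hd₀n, hd₁n, hd₀₁] at hcore
  rw [ha₀n, ha₁n, ha₀₁, hwc]
  have hI2 : (n₀ ^ 2 * gc₀ + ‖α‖ ^ 2 * gc₁ + 2 * ((n₀ : ℂ) * α * conj w).re) * (n₁ ^ 2 * gc₁)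
        - ‖(n₁ : ℂ) * ((n₀ : ℂ) * w + α * gc₁)‖ ^ 2
      = (n₀ ^ 2 * (‖α‖ ^ 2 + n₁ ^ 2) - ‖(n₀ : ℂ) * α‖ ^ 2) * (gc₀ * gc₁ - ‖w‖ ^ 2) := by
    have e1 : ‖(n₁ : ℂ) * ((n₀ : ℂ) * w + α * gc₁)‖ ^ 2
        = n₁ ^ 2 * (n₀ ^ 2 * ‖w‖ ^ 2 + ‖α‖ ^ 2 * gc₁ ^ 2 + 2 * gc₁ * ((n₀ : ℂ) * α * conj w).re) := by
      rw [Complex.sq_norm, Complex.sq_norm, Complex.sq_norm]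
      simp only [Complex.normSq_apply, Complex.mul_re, Complex.mul_im, Complex.add_re, Complex.add_im,
        Complex.ofReal_re, Complex.ofReal_im, Complex.conj_re, Complex.conj_im]
      ring
    have e2 : ‖(n₀ : ℂ) * α‖ ^ 2 = n₀ ^ 2 * ‖α‖ ^ 2 := by
      rw [norm_mul, Complex.norm_real, Real.norm_of_nonneg hn₀0, mul_pow]
    rw [e1, e2]; ring
  rw [hI2] at hcore
  have hI1 : n₀ ^ 2 * gc₀ + ‖α‖ ^ 2 * gc₁ + 2 * ((n₀ : ℂ) * α * conj w).re + n₁ ^ 2 * gc₁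
      = n₀ ^ 2 * gc₀ + (‖α‖ ^ 2 + n₁ ^ 2) * gc₁ + 2 * ((n₀ : ℂ) * α * conj w).re := by ring
  linarith [hcore, hI1]

end Summit.MatrixMultiplication.MatrixMultiplication.Theorems.RankTwoAdditivity
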